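import Literature.AlgebraicGeometry.Resolution.CommonAdmissibleBlowup
import Literature.AlgebraicGeometry.Resolution.StrictTransformFlatteningBaseReduction
import Literature.AlgebraicGeometry.Limits.PushoutOpenImmersion
import Literature.AlgebraicGeometry.Morphisms.NagataCompactification
import Literature.AlgebraicGeometry.Morphisms.AffineSpaceCompactification
import HarnessLib

/-!
# Compactifications glue along the base after admissible blowing up: Nagata's theorem over a
# quasi-compact quasi-separated base from the case of an affine base

Topic: `Literature/AlgebraicGeometry/Morphisms`. The last step of Nagata's compactification
theorem (`NagataCompactification`, Stacks 0F41; Conrad 2007, Thm. 4.1) is the passage from a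
Noetherian (or affine) base to an arbitrary quasi-compact and quasi-separated base `S`. The
printed proofs do this by absolute Noetherian approximation (Conrad, Thm. 4.3 and [TT, Thm. C.9];
Stacks, Tag 0F41, first paragraph of the proof: Limits, Proposition 9.6, Proposition 5.4,
Lemma 10.1 and Lemma 8.6), which the tree does not have beyond an affine base
(`Limits.exists_finiteTypeModel`, Stacks 09ZP, used in
`exists_compactification_affineBase_of_twoPiece`). Here we replace it by the observation that
**compactifiability is Zariski-local on the base** once Raynaud–Gruson flattening is available:
if `S = V ∪ W` and `X_V → V`, `X_W → W` have compactifications `X̄₁ → V`, `X̄₂ → W`, then over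
`V ∩ W` the two compactifications of `X_{V ∩ W}` have a common `X_{V ∩ W}`-admissible blowing up
`T` (Conrad 2007, Remark 2.12 / Thm. 2.11 = Stacks 081T, conditional on Stacks 081R:
`Resolution.exists_common_admissible_blowup_of_stacks081R`); the two centres, ideal sheaves of
finite type on the quasi-compact opens `X̄ᵢ|_{V ∩ W}` not meeting `X`, extend to ideal sheaves of
finite type on `X̄ᵢ` not meeting `X` (Stacks 080N/01PF, `Resolution.exists_fg_comap_ι_eq_of_disjoint`),
and after blowing these up (`Resolution.exists_isBlowup`, proper by Stacks 02NS) the two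
compactifications become isomorphic over `V ∩ W` (blowing up commutes with restriction to opens,
`IsBlowup.restrict`, and is unique, `IsBlowup.unique`), so they glue (pushout along the open
immersions of `T`, `Limits/PushoutOpenImmersion.lean`) to a scheme proper over `S` (properness
is Zariski-local on the base) containing `X = X_V ∪ X_W` as an open subscheme (the open
immersions `X_V → X̄₁' → X̄`, `X_W → X̄₂' → X̄` agree on `X_{V ∩ W}`, where both factor through
`T`, and glue, `Scheme.Cover.glueMorphisms`; being an open immersion is Zariski-local on the
target). Induction over a finite affine open cover of `S` then reduces Nagata's theorem to the
case of an affine base, i.e. (by `exists_compactification_affineBase_of_twoPiece` and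
`exists_compactification_of_isAffine`) to the two-piece lemma Stacks 0F40 and to `Stacks081R`.

* `exists_compactification_of_arrow_iso` — compactifiability is invariant under isomorphisms
  of arrows;
* `exists_compactification_of_iSup_eq_top₂` — **gluing two compactifications given over the
  members `V, W` of an open cover of the base** (conditional on `Stacks081R`);
* `exists_compactification_of_forall_affineOpens` — **compactifiability over a quasi-compact
  quasi-separated base follows from compactifiability over its affine opens** (conditional on
  `Stacks081R`);
* `nagataCompactification_of_stacks081R_of_twoPiece` — **`NagataCompactification` from
  `Stacks081R` and the two-piece lemma Stacks 0F40** (the latter as a hypothesis, in the form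
  used by `exists_compactification_affineBase_of_twoPiece`).

Everything here is proved; the named fact `Resolution.Stacks081R` (Raynaud–Gruson 1971,
Thm. 5.2.2) enters only as the hypothesis `h081R`.

## References

* B. Conrad, *Deligne's notes on Nagata compactifications*, J. Ramanujan Math. Soc. 22 (2007),
  Thm. 4.1, Thm. 2.11, Remark 2.12, §4 (gluing). [Conrad2007]
* The Stacks Project, Tags 0F41, 0F40, 081T, 080N, 01PF, 02NS, 01LH. [StacksProject]
* M. Raynaud, L. Gruson, *Critères de platitude et de projectivité*, Invent. Math. 13 (1971),
  Première partie, Thm. 5.2.2. [RaynaudGruson1971]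
-/

noncomputable section

-- Mathlib's pull-back API is stated through `abbrev`s over `limit`; as in Mathlib's own
-- algebraic-geometry files we let `simp`/unification see through them.
set_option backward.isDefEq.respectTransparency false

open CategoryTheory CategoryTheory.Limits AlgebraicGeometry TopologicalSpace

namespace Literature.AlgebraicGeometry.Morphisms

universe u

open Literature.AlgebraicGeometry.Resolution Literature.AlgebraicGeometry.Limits

/-! ## Transport of compactifications -/

/-- **Compactifiability is invariant under isomorphisms of arrows.** [folklore] -/
theorem exists_compactification_of_arrow_iso {X S X' S' : Scheme.{u}} {f : X ⟶ S}
    {f' : X' ⟶ S'} (e : Arrow.mk f ≅ Arrow.mk f')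
    (h : ∃ (Y : Scheme.{u}) (j : X ⟶ Y) (q : Y ⟶ S), IsOpenImmersion j ∧ IsProper q ∧ j ≫ q = f) :
    ∃ (Y : Scheme.{u}) (j : X' ⟶ Y) (q : Y ⟶ S'),
      IsOpenImmersion j ∧ IsProper q ∧ j ≫ q = f' := by
  obtain ⟨Y, j, q, hj, hq, hjq⟩ := h
  have w : f ≫ e.hom.right = e.hom.left ≫ f' := (Arrow.w e.hom).symm
  have hl : e.inv.left ≫ e.hom.left = 𝟙 _ := Arrow.inv_hom_id_left e
  refine ⟨Y, e.inv.left ≫ j, q ≫ e.hom.right, inferInstance, inferInstance, ?_⟩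
  rw [Category.assoc, reassoc_of% hjq, w, reassoc_of% hl]

/-- **Restricting a compactification of `f|_U` to a smaller open `U' ≤ U` of the base**: a
compactification of `f|_U` yields one of `(f|_U)|_{U'}` (base change to the open `U'`), i.e.
of `f|_{U'}`. [folklore] -/
theorem exists_compactification_morphismRestrict_of_le {X S : Scheme.{u}} (f : X ⟶ S)
    {U U' : S.Opens} (hU' : U' ≤ U)
    (h : ∃ (Y : Scheme.{u}) (j : ↑(f ⁻¹ᵁ U) ⟶ Y) (q : Y ⟶ U),
      IsOpenImmersion j ∧ IsProper q ∧ j ≫ q = f ∣_ U) :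
    ∃ (Y : Scheme.{u}) (j : ↑(f ⁻¹ᵁ U') ⟶ Y) (q : Y ⟶ U'),
      IsOpenImmersion j ∧ IsProper q ∧ j ≫ q = f ∣_ U' := by
  -- base change to the open `U ↓ U'` of `U`, then identify `(f|_U)|_{U↓U'}` with `f|_{U'}`
  have h' := exists_compactification_pullback_snd (f ∣_ U) (U.ι ⁻¹ᵁ U').ι h
  have e₁ : Arrow.mk (pullback.snd (f ∣_ U) (U.ι ⁻¹ᵁ U').ι) ≅ Arrow.mk (f ∣_ U ∣_ (U.ι ⁻¹ᵁ U')) :=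
    Arrow.isoMk' _ _ (pullbackRestrictIsoRestrict (f ∣_ U) (U.ι ⁻¹ᵁ U')) (Iso.refl _)
      (by rw [Iso.refl_hom, Category.comp_id, pullbackRestrictIsoRestrict_hom_morphismRestrict])
  have hUU' : U.ι ''ᵁ (U.ι ⁻¹ᵁ U') = U' := by
    rw [Scheme.Hom.image_preimage_eq_opensRange_inf, Scheme.Opens.opensRange_ι, inf_eq_right]
    exact hU'
  exact exists_compactification_of_arrow_iso
    (e₁ ≪≫ morphismRestrictRestrict f U (U.ι ⁻¹ᵁ U') ≪≫ morphismRestrictEq f hUU')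
    h'

/-! ## Gluing two compactifications along the base -/

/-- **Compactifications glue along the base after admissible blowing up** (see the module
docstring). Let `S` be quasi-compact and quasi-separated, `f : X → S` quasi-compact, and
`S = V ∪ W` with `V, W` quasi-compact opens. If `f|_V : f⁻¹V → V` and `f|_W : f⁻¹W → W` both
factor as an open immersion followed by a proper morphism, then so does `f`. Conditional on
`Stacks081R` (Raynaud–Gruson flattening), through the common admissible blowing up of two
compactifications (Conrad 2007, Remark 2.12). [cite: Conrad2007, Remark 2.12 and §4] -/
theorem exists_compactification_of_iSup_eq_top₂ (h081R : Stacks081R.{u}) {X S : Scheme.{u}}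
    [QuasiSeparatedSpace S] (f : X ⟶ S) [QuasiCompact f]
    (V W : S.Opens) (hV : IsCompact (V : Set S)) (hW : IsCompact (W : Set S)) (hVW : V ⊔ W = ⊤)
    (h₁ : ∃ (Y : Scheme.{u}) (j : ↑(f ⁻¹ᵁ V) ⟶ Y) (q : Y ⟶ V),
      IsOpenImmersion j ∧ IsProper q ∧ j ≫ q = f ∣_ V)
    (h₂ : ∃ (Y : Scheme.{u}) (j : ↑(f ⁻¹ᵁ W) ⟶ Y) (q : Y ⟶ W),
      IsOpenImmersion j ∧ IsProper q ∧ j ≫ q = f ∣_ W) :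
    ∃ (Y : Scheme.{u}) (j : X ⟶ Y) (q : Y ⟶ S), IsOpenImmersion j ∧ IsProper q ∧ j ≫ q = f := by
  obtain ⟨Y₁, j₁, q₁, hj₁, hq₁, hjq₁⟩ := h₁
  obtain ⟨Y₂, j₂, q₂, hj₂, hq₂, hjq₂⟩ := h₂
  haveI := hj₁
  haveI := hj₂
  haveI := hq₁
  haveI := hq₂
  /- the structure morphisms `πᵢ : Yᵢ → S` -/
  obtain ⟨π₁, hπ₁, hπ₁V⟩ : ∃ π₁ : Y₁ ⟶ S, π₁ = q₁ ≫ V.ι ∧ ∀ y, π₁ y ∈ V :=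
    ⟨q₁ ≫ V.ι, rfl, fun y => (q₁ y).2⟩
  obtain ⟨π₂, hπ₂, hπ₂W⟩ : ∃ π₂ : Y₂ ⟶ S, π₂ = q₂ ≫ W.ι ∧ ∀ y, π₂ y ∈ W :=
    ⟨q₂ ≫ W.ι, rfl, fun y => (q₂ y).2⟩
  have hjπ₁ : j₁ ≫ π₁ = (f ⁻¹ᵁ V).ι ≫ f := by rw [hπ₁, reassoc_of% hjq₁, morphismRestrict_ι]
  have hjπ₂ : j₂ ≫ π₂ = (f ⁻¹ᵁ W).ι ≫ f := by rw [hπ₂, reassoc_of% hjq₂, morphismRestrict_ι]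
  haveI : IsSeparated π₁ := by rw [hπ₁]; infer_instance
  haveI : IsSeparated π₂ := by rw [hπ₂]; infer_instance
  /- topological bookkeeping -/
  haveI : CompactSpace V := isCompact_iff_compactSpace.mp hV
  haveI : CompactSpace W := isCompact_iff_compactSpace.mp hW
  haveI : QuasiSeparatedSpace V := QuasiSeparatedSpace.of_isOpenEmbedding V.ι.isOpenEmbedding
  haveI : QuasiSeparatedSpace W := QuasiSeparatedSpace.of_isOpenEmbedding W.ι.isOpenEmbedding
  haveI : CompactSpace ↑(f ⁻¹ᵁ V) := isCompact_iff_compactSpace.mp (f.isCompact_preimage hV)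
  haveI : CompactSpace ↑(f ⁻¹ᵁ W) := isCompact_iff_compactSpace.mp (f.isCompact_preimage hW)
  haveI : CompactSpace Y₁ := QuasiCompact.compactSpace_of_compactSpace q₁
  haveI : CompactSpace Y₂ := QuasiCompact.compactSpace_of_compactSpace q₂
  haveI : QuasiSeparatedSpace Y₁ := quasiSeparatedSpace_of_quasiSeparated q₁
  haveI : QuasiSeparatedSpace Y₂ := quasiSeparatedSpace_of_quasiSeparated q₂
  haveI : QuasiCompact π₁ := by rw [hπ₁]; infer_instance
  haveI : QuasiCompact π₂ := by rw [hπ₂]; infer_instance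
  /- `πᵢ` is proper over `V` (resp. `W`): `πᵢ|_V ≅ qᵢ` -/
  have hpbq₁ : IsPullback q₁ (𝟙 Y₁) V.ι π₁ :=
    IsOpenImmersion.isPullback q₁ (𝟙 Y₁) V.ι π₁ (by rw [Category.id_comp, hπ₁]) (by
      rw [Scheme.Opens.opensRange_ι, Scheme.Hom.opensRange_of_isIso]
      exact Opens.ext (Set.eq_univ_of_forall fun y => hπ₁V y))
  have hpbq₂ : IsPullback q₂ (𝟙 Y₂) W.ι π₂ :=
    IsOpenImmersion.isPullback q₂ (𝟙 Y₂) W.ι π₂ (by rw [Category.id_comp, hπ₂]) (by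
      rw [Scheme.Opens.opensRange_ι, Scheme.Hom.opensRange_of_isIso]
      exact Opens.ext (Set.eq_univ_of_forall fun y => hπ₂W y))
  haveI : IsProper (π₁ ∣_ V) := by
    rw [← (isPullback_morphismRestrict π₁ V).isoIsPullback_hom_fst _ _ hpbq₁]
    infer_instance
  haveI : IsProper (π₂ ∣_ W) := by
    rw [← (isPullback_morphismRestrict π₂ W).isoIsPullback_hom_fst _ _ hpbq₂]
    infer_instance
  /- the overlap `B = V ∩ W` and the pieces over it -/
  obtain ⟨B, hB⟩ : ∃ B : S.Opens, B = V ⊓ W := ⟨_, rfl⟩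
  have hBV : B ≤ V := hB ▸ inf_le_left
  have hBW : B ≤ W := hB ▸ inf_le_right
  have hBc : IsCompact (B : Set S) := by
    rw [hB, Opens.coe_inf]
    exact hV.inter_of_isOpen hW V.2 W.2
  haveI : CompactSpace B := isCompact_iff_compactSpace.mp hBc
  haveI : QuasiSeparatedSpace B := QuasiSeparatedSpace.of_isOpenEmbedding B.ι.isOpenEmbedding
  haveI : CompactSpace ↑(f ⁻¹ᵁ B) := isCompact_iff_compactSpace.mp (f.isCompact_preimage hBc)
  haveI : IsProper (π₁ ∣_ B) := of_morphismRestrict_of_le (P := @IsProper) π₁ hBV inferInstance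
  haveI : IsProper (π₂ ∣_ B) := of_morphismRestrict_of_le (P := @IsProper) π₂ hBW inferInstance
  have hle₁ : f ⁻¹ᵁ B ≤ f ⁻¹ᵁ V := fun x hx => hBV hx
  have hle₂ : f ⁻¹ᵁ B ≤ f ⁻¹ᵁ W := fun x hx => hBW hx
  -- `eᵢ : f⁻¹B → πᵢ⁻¹B`, the restriction of `jᵢ`
  have hr₁ : Set.range (X.homOfLE hle₁ ≫ j₁) ⊆ Set.range (π₁ ⁻¹ᵁ B).ι := by
    rw [Scheme.Opens.range_ι]
    rintro _ ⟨x, rfl⟩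
    show π₁ ((X.homOfLE hle₁ ≫ j₁) x) ∈ B
    rw [← Scheme.Hom.comp_apply, Category.assoc, hjπ₁, Scheme.homOfLE_ι_assoc,
      Scheme.Hom.comp_apply, Scheme.Opens.ι_apply]
    exact x.2
  have hr₂ : Set.range (X.homOfLE hle₂ ≫ j₂) ⊆ Set.range (π₂ ⁻¹ᵁ B).ι := by
    rw [Scheme.Opens.range_ι]
    rintro _ ⟨x, rfl⟩
    show π₂ ((X.homOfLE hle₂ ≫ j₂) x) ∈ B
    rw [← Scheme.Hom.comp_apply, Category.assoc, hjπ₂, Scheme.homOfLE_ι_assoc,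
      Scheme.Hom.comp_apply, Scheme.Opens.ι_apply]
    exact x.2
  obtain ⟨e₁, he₁ι, he₁o⟩ : ∃ e₁ : ↑(f ⁻¹ᵁ B) ⟶ ↑(π₁ ⁻¹ᵁ B),
      e₁ ≫ (π₁ ⁻¹ᵁ B).ι = X.homOfLE hle₁ ≫ j₁ ∧ IsOpenImmersion e₁ := by
    refine ⟨IsOpenImmersion.lift (π₁ ⁻¹ᵁ B).ι _ hr₁, IsOpenImmersion.lift_fac _ _ _, ?_⟩
    haveI : IsOpenImmersion (IsOpenImmersion.lift (π₁ ⁻¹ᵁ B).ι _ hr₁ ≫ (π₁ ⁻¹ᵁ B).ι) := by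
      rw [IsOpenImmersion.lift_fac]
      infer_instance
    exact IsOpenImmersion.of_comp _ (π₁ ⁻¹ᵁ B).ι
  obtain ⟨e₂, he₂ι, he₂o⟩ : ∃ e₂ : ↑(f ⁻¹ᵁ B) ⟶ ↑(π₂ ⁻¹ᵁ B),
      e₂ ≫ (π₂ ⁻¹ᵁ B).ι = X.homOfLE hle₂ ≫ j₂ ∧ IsOpenImmersion e₂ := by
    refine ⟨IsOpenImmersion.lift (π₂ ⁻¹ᵁ B).ι _ hr₂, IsOpenImmersion.lift_fac _ _ _, ?_⟩
    haveI : IsOpenImmersion (IsOpenImmersion.lift (π₂ ⁻¹ᵁ B).ι _ hr₂ ≫ (π₂ ⁻¹ᵁ B).ι) := by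
      rw [IsOpenImmersion.lift_fac]
      infer_instance
    exact IsOpenImmersion.of_comp _ (π₂ ⁻¹ᵁ B).ι
  haveI := he₁o
  haveI := he₂o
  have heq₁ : e₁ ≫ (π₁ ∣_ B) = f ∣_ B := by
    rw [← cancel_mono B.ι, Category.assoc, morphismRestrict_ι, reassoc_of% he₁ι, hjπ₁,
      Scheme.homOfLE_ι_assoc, morphismRestrict_ι]
  have heq₂ : e₂ ≫ (π₂ ∣_ B) = f ∣_ B := by
    rw [← cancel_mono B.ι, Category.assoc, morphismRestrict_ι, reassoc_of% he₂ι, hjπ₂,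
      Scheme.homOfLE_ι_assoc, morphismRestrict_ι]
  /- Step 1: a common admissible blowing up `T` of the two compactifications over `B` -/
  obtain ⟨T, e, t₁, t₂, K₁, K₂, he, het₁, het₂, ht, hK₁fg, hK₁U, hK₁, hK₂fg, hK₂U, hK₂⟩ :=
    exists_common_admissible_blowup_of_stacks081R h081R e₁ (π₁ ∣_ B) e₂ (π₂ ∣_ B)
      (heq₁.trans heq₂.symm)
  haveI := he
  /- Step 2: extend the centres to `jᵢ(f⁻¹Vᵢ)`-admissible centres `Gᵢ` on `Yᵢ` -/
  have hcpt₁ : IsCompact ((π₁ ⁻¹ᵁ B : Y₁.Opens) : Set Y₁) := π₁.isCompact_preimage hBc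
  have hcpt₂ : IsCompact ((π₂ ⁻¹ᵁ B : Y₂.Opens) : Set Y₂) := π₂.isCompact_preimage hBc
  have hK₁U' : Disjoint (((π₁ ⁻¹ᵁ B).ι ⁻¹ᵁ j₁.opensRange : (↑(π₁ ⁻¹ᵁ B) : Scheme.{u}).Opens) :
      Set ↑(π₁ ⁻¹ᵁ B)) (K₁.support : Set ↑(π₁ ⁻¹ᵁ B)) := by
    refine Set.disjoint_left.mpr fun y hy hyK => Set.disjoint_left.mp hK₁U ?_ hyK
    obtain ⟨x, hx⟩ : (π₁ ⁻¹ᵁ B).ι y ∈ j₁.opensRange := hy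
    have hxB : x.1 ∈ f ⁻¹ᵁ B := by
      show f x.1 ∈ B
      have h1 : f x.1 = π₁ (j₁ x) := by
        rw [← Scheme.Opens.ι_apply, ← Scheme.Hom.comp_apply, ← hjπ₁, Scheme.Hom.comp_apply]
      rw [h1, hx]
      exact y.2
    have hx' : X.homOfLE hle₁ ⟨x.1, hxB⟩ = x := Subtype.ext (Scheme.homOfLE_apply hle₁ _)
    refine ⟨⟨x.1, hxB⟩, (π₁ ⁻¹ᵁ B).ι.isOpenEmbedding.injective ?_⟩
    rw [← Scheme.Hom.comp_apply, he₁ι, Scheme.Hom.comp_apply, hx', hx]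
  have hK₂U' : Disjoint (((π₂ ⁻¹ᵁ B).ι ⁻¹ᵁ j₂.opensRange : (↑(π₂ ⁻¹ᵁ B) : Scheme.{u}).Opens) :
      Set ↑(π₂ ⁻¹ᵁ B)) (K₂.support : Set ↑(π₂ ⁻¹ᵁ B)) := by
    refine Set.disjoint_left.mpr fun y hy hyK => Set.disjoint_left.mp hK₂U ?_ hyK
    obtain ⟨x, hx⟩ : (π₂ ⁻¹ᵁ B).ι y ∈ j₂.opensRange := hy
    have hxB : x.1 ∈ f ⁻¹ᵁ B := by
      show f x.1 ∈ B
      have h1 : f x.1 = π₂ (j₂ x) := by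
        rw [← Scheme.Opens.ι_apply, ← Scheme.Hom.comp_apply, ← hjπ₂, Scheme.Hom.comp_apply]
      rw [h1, hx]
      exact y.2
    have hx' : X.homOfLE hle₂ ⟨x.1, hxB⟩ = x := Subtype.ext (Scheme.homOfLE_apply hle₂ _)
    refine ⟨⟨x.1, hxB⟩, (π₂ ⁻¹ᵁ B).ι.isOpenEmbedding.injective ?_⟩
    rw [← Scheme.Hom.comp_apply, he₂ι, Scheme.Hom.comp_apply, hx', hx]
  obtain ⟨G₁, hG₁fg, hG₁K, hG₁U⟩ := exists_fg_comap_ι_eq_of_disjoint j₁.opensRange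
    (isCompact_range j₁.continuous) (π₁ ⁻¹ᵁ B) hcpt₁ K₁ hK₁fg hK₁U'
  obtain ⟨G₂, hG₂fg, hG₂K, hG₂U⟩ := exists_fg_comap_ι_eq_of_disjoint j₂.opensRange
    (isCompact_range j₂.continuous) (π₂ ⁻¹ᵁ B) hcpt₂ K₂ hK₂fg hK₂U'
  /- Step 3: blow up `Yᵢ` in `Gᵢ`; `jᵢ` lifts, and over `πᵢ⁻¹B` we recover `T` -/
  obtain ⟨Y₁', c₁, hc₁⟩ := exists_isBlowup Y₁ G₁
  obtain ⟨Y₂', c₂, hc₂⟩ := exists_isBlowup Y₂ G₂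
  haveI : IsProper c₁ := IsBlowup.isProper_of_fg hG₁fg hc₁
  haveI : IsProper c₂ := IsBlowup.isProper_of_fg hG₂fg hc₂
  haveI : IsIso (c₁ ∣_ j₁.opensRange) := hc₁.isIso_morphismRestrict hG₁U
  haveI : IsIso (c₂ ∣_ j₂.opensRange) := hc₂.isIso_morphismRestrict hG₂U
  obtain ⟨j₁', hj₁'c, hj₁'o⟩ : ∃ j₁' : ↑(f ⁻¹ᵁ V) ⟶ Y₁', j₁' ≫ c₁ = j₁ ∧ IsOpenImmersion j₁' :=
    ⟨j₁.isoOpensRange.hom ≫ inv (c₁ ∣_ j₁.opensRange) ≫ (c₁ ⁻¹ᵁ j₁.opensRange).ι, by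
      rw [Category.assoc, Category.assoc, ← morphismRestrict_ι, IsIso.inv_hom_id_assoc,
        Scheme.Hom.isoOpensRange_hom_ι], inferInstance⟩
  obtain ⟨j₂', hj₂'c, hj₂'o⟩ : ∃ j₂' : ↑(f ⁻¹ᵁ W) ⟶ Y₂', j₂' ≫ c₂ = j₂ ∧ IsOpenImmersion j₂' :=
    ⟨j₂.isoOpensRange.hom ≫ inv (c₂ ∣_ j₂.opensRange) ≫ (c₂ ⁻¹ᵁ j₂.opensRange).ι, by
      rw [Category.assoc, Category.assoc, ← morphismRestrict_ι, IsIso.inv_hom_id_assoc,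
        Scheme.Hom.isoOpensRange_hom_ι], inferInstance⟩
  haveI := hj₁'o
  haveI := hj₂'o
  -- `cᵢ` restricted over `πᵢ⁻¹B` is the blowing up in `Kᵢ`, hence isomorphic to `T`
  have hc₁B : IsBlowup (c₁ ∣_ (π₁ ⁻¹ᵁ B)) K₁ := hG₁K ▸ hc₁.restrict (π₁ ⁻¹ᵁ B)
  have hc₂B : IsBlowup (c₂ ∣_ (π₂ ⁻¹ᵁ B)) K₂ := hG₂K ▸ hc₂.restrict (π₂ ⁻¹ᵁ B)
  obtain ⟨φ₁, hφ₁, -⟩ := hK₁.unique hc₁B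
  obtain ⟨φ₂, hφ₂, -⟩ := hK₂.unique hc₂B
  obtain ⟨u₁, hu₁c, hu₁o, hru₁⟩ : ∃ u₁ : T ⟶ Y₁', u₁ ≫ c₁ = t₁ ≫ (π₁ ⁻¹ᵁ B).ι ∧
      IsOpenImmersion u₁ ∧ Set.range u₁ = ((c₁ ⁻¹ᵁ (π₁ ⁻¹ᵁ B) : Y₁'.Opens) : Set Y₁') := by
    refine ⟨φ₁.hom ≫ (c₁ ⁻¹ᵁ (π₁ ⁻¹ᵁ B)).ι, ?_, inferInstance, ?_⟩
    · rw [Category.assoc, ← morphismRestrict_ι, reassoc_of% hφ₁]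
    · rw [← Scheme.Opens.range_ι (c₁ ⁻¹ᵁ (π₁ ⁻¹ᵁ B))]
      refine Set.Subset.antisymm (by rintro _ ⟨x, rfl⟩; exact ⟨_, (Scheme.Hom.comp_apply _ _ x).symm⟩)
        ?_
      rintro _ ⟨y, rfl⟩
      obtain ⟨x, rfl⟩ := (Scheme.homeoOfIso φ₁).surjective y
      exact ⟨x, Scheme.Hom.comp_apply _ _ x⟩
  obtain ⟨u₂, hu₂c, hu₂o, hru₂⟩ : ∃ u₂ : T ⟶ Y₂', u₂ ≫ c₂ = t₂ ≫ (π₂ ⁻¹ᵁ B).ι ∧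
      IsOpenImmersion u₂ ∧ Set.range u₂ = ((c₂ ⁻¹ᵁ (π₂ ⁻¹ᵁ B) : Y₂'.Opens) : Set Y₂') := by
    refine ⟨φ₂.hom ≫ (c₂ ⁻¹ᵁ (π₂ ⁻¹ᵁ B)).ι, ?_, inferInstance, ?_⟩
    · rw [Category.assoc, ← morphismRestrict_ι, reassoc_of% hφ₂]
    · rw [← Scheme.Opens.range_ι (c₂ ⁻¹ᵁ (π₂ ⁻¹ᵁ B))]
      refine Set.Subset.antisymm (by rintro _ ⟨x, rfl⟩; exact ⟨_, (Scheme.Hom.comp_apply _ _ x).symm⟩)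
        ?_
      rintro _ ⟨y, rfl⟩
      obtain ⟨x, rfl⟩ := (Scheme.homeoOfIso φ₂).surjective y
      exact ⟨x, Scheme.Hom.comp_apply _ _ x⟩
  haveI := hu₁o
  haveI := hu₂o
  -- the lifts of `jᵢ` restricted to `f⁻¹B` both come from `e : f⁻¹B → T`
  have hej₁ : X.homOfLE hle₁ ≫ j₁' = e ≫ u₁ := by
    have hcomp : (X.homOfLE hle₁ ≫ j₁') ≫ c₁ = (e ≫ u₁) ≫ c₁ := by
      rw [Category.assoc, hj₁'c, Category.assoc, hu₁c, reassoc_of% het₁, he₁ι]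
    refine eq_of_comp_eq_of_isIso_morphismRestrict c₁ j₁.opensRange hcomp fun x => ?_
    rw [← Scheme.Hom.comp_apply, Category.assoc, hj₁'c, Scheme.Hom.comp_apply]
    exact ⟨_, rfl⟩
  have hej₂ : X.homOfLE hle₂ ≫ j₂' = e ≫ u₂ := by
    have hcomp : (X.homOfLE hle₂ ≫ j₂') ≫ c₂ = (e ≫ u₂) ≫ c₂ := by
      rw [Category.assoc, hj₂'c, Category.assoc, hu₂c, reassoc_of% het₂, he₂ι]
    refine eq_of_comp_eq_of_isIso_morphismRestrict c₂ j₂.opensRange hcomp fun x => ?_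
    rw [← Scheme.Hom.comp_apply, Category.assoc, hj₂'c, Scheme.Hom.comp_apply]
    exact ⟨_, rfl⟩
  /- Step 4: glue `Y₁'` and `Y₂'` along `T` -/
  have hu : u₁ ≫ c₁ ≫ π₁ = u₂ ≫ c₂ ≫ π₂ := by
    rw [reassoc_of% hu₁c, reassoc_of% hu₂c, ← morphismRestrict_ι, ← morphismRestrict_ι,
      reassoc_of% ht]
  haveI := isOpenImmersion_inl u₁ u₂
  haveI := isOpenImmersion_inr u₁ u₂
  obtain ⟨ρ, hlρ, hrρ⟩ : ∃ ρ : pushout u₁ u₂ ⟶ S, pushout.inl u₁ u₂ ≫ ρ = c₁ ≫ π₁ ∧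
      pushout.inr u₁ u₂ ≫ ρ = c₂ ≫ π₂ :=
    ⟨pushout.desc _ _ hu, pushout.inl_desc _ _ _, pushout.inr_desc _ _ _⟩
  have hcov := range_inl_union_range_inr u₁ u₂
  -- `ρ⁻¹(V) = Y₁'` and `ρ⁻¹(W) = Y₂'`
  have hρV : ρ ⁻¹ᵁ V = (pushout.inl u₁ u₂).opensRange := by
    ext z
    constructor
    · intro hz
      replace hz : ρ z ∈ V := hz
      rcases Set.eq_univ_iff_forall.mp hcov z with ⟨y, rfl⟩ | ⟨y, rfl⟩
      · exact ⟨y, rfl⟩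
      · rw [← Scheme.Hom.comp_apply, hrρ, Scheme.Hom.comp_apply] at hz
        have hy : y ∈ ((c₂ ⁻¹ᵁ (π₂ ⁻¹ᵁ B) : Y₂'.Opens) : Set Y₂') := by
          show π₂ (c₂ y) ∈ B
          rw [hB]
          exact ⟨hz, hπ₂W _⟩
        rw [← hru₂] at hy
        obtain ⟨x, rfl⟩ := hy
        exact ⟨u₁ x, by rw [← Scheme.Hom.comp_apply, pushout.condition, Scheme.Hom.comp_apply]⟩
    · rintro ⟨y, rfl⟩
      show ρ (pushout.inl u₁ u₂ y) ∈ V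
      rw [← Scheme.Hom.comp_apply, hlρ, Scheme.Hom.comp_apply]
      exact hπ₁V _
  have hρW : ρ ⁻¹ᵁ W = (pushout.inr u₁ u₂).opensRange := by
    ext z
    constructor
    · intro hz
      replace hz : ρ z ∈ W := hz
      rcases Set.eq_univ_iff_forall.mp hcov z with ⟨y, rfl⟩ | ⟨y, rfl⟩
      · rw [← Scheme.Hom.comp_apply, hlρ, Scheme.Hom.comp_apply] at hz
        have hy : y ∈ ((c₁ ⁻¹ᵁ (π₁ ⁻¹ᵁ B) : Y₁'.Opens) : Set Y₁') := by
          show π₁ (c₁ y) ∈ B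
          rw [hB]
          exact ⟨hπ₁V _, hz⟩
        rw [← hru₁] at hy
        obtain ⟨x, rfl⟩ := hy
        exact ⟨u₂ x, by rw [← Scheme.Hom.comp_apply, ← pushout.condition, Scheme.Hom.comp_apply]⟩
      · exact ⟨y, rfl⟩
    · rintro ⟨y, rfl⟩
      show ρ (pushout.inr u₁ u₂ y) ∈ W
      rw [← Scheme.Hom.comp_apply, hrρ, Scheme.Hom.comp_apply]
      exact hπ₂W _
  -- `ρ` is proper: Zariski-locally over `V` and `W` it is `cᵢ ≫ qᵢ`
  have hpbV : IsPullback (c₁ ≫ q₁) (pushout.inl u₁ u₂) V.ι ρ :=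
    IsOpenImmersion.isPullback _ _ _ _ (by rw [hlρ, hπ₁, Category.assoc])
      (by rw [Scheme.Opens.opensRange_ι, hρV])
  have hpbW : IsPullback (c₂ ≫ q₂) (pushout.inr u₁ u₂) W.ι ρ :=
    IsOpenImmersion.isPullback _ _ _ _ (by rw [hrρ, hπ₂, Category.assoc])
      (by rw [Scheme.Opens.opensRange_ι, hρW])
  haveI : IsProper ρ := by
    apply IsZariskiLocalAtTarget.of_iSup_eq_top (P := @IsProper) (fun b : Bool => cond b V W)
      (by rw [iSup_bool_eq]; exact hVW)
    rintro (_ | _)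
    · change IsProper (ρ ∣_ W)
      rw [← (isPullback_morphismRestrict ρ W).isoIsPullback_hom_fst _ _ hpbW]
      infer_instance
    · change IsProper (ρ ∣_ V)
      rw [← (isPullback_morphismRestrict ρ V).isoIsPullback_hom_fst _ _ hpbV]
      infer_instance
  /- Step 5: the open immersion `X → Y₁' ⨿_T Y₂'`, glued from `j₁'` and `j₂'` -/
  have hXcov : (f ⁻¹ᵁ V) ⊔ (f ⁻¹ᵁ W) = ⊤ := by
    apply Opens.ext
    rw [Opens.coe_sup, Opens.coe_top, Set.eq_univ_iff_forall]
    intro x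
    have hx : f x ∈ (V ⊔ W : S.Opens) := by rw [hVW]; trivial
    exact hx
  let 𝒰 : X.OpenCover := X.openCoverOfIsOpenCover (fun b : Bool => cond b (f ⁻¹ᵁ V) (f ⁻¹ᵁ W))
    (TopologicalSpace.IsOpenCover.mk (by rw [iSup_bool_eq]; exact hXcov))
  let g : ∀ b : Bool, 𝒰.X b ⟶ pushout u₁ u₂ := fun b =>
    match b with
    | true => j₁' ≫ pushout.inl u₁ u₂
    | false => j₂' ≫ pushout.inr u₁ u₂
  -- compatibility on the overlap `f⁻¹B`: both maps factor through `e : f⁻¹B → T`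
  have hcompat : ∀ {P : Scheme.{u}} (a : P ⟶ ↑(f ⁻¹ᵁ V)) (b : P ⟶ ↑(f ⁻¹ᵁ W)),
      a ≫ (f ⁻¹ᵁ V).ι = b ≫ (f ⁻¹ᵁ W).ι →
      a ≫ j₁' ≫ pushout.inl u₁ u₂ = b ≫ j₂' ≫ pushout.inr u₁ u₂ := by
    intro P a b hab
    have hrange : Set.range (a ≫ (f ⁻¹ᵁ V).ι) ⊆ Set.range (f ⁻¹ᵁ B).ι := by
      rw [Scheme.Opens.range_ι]
      rintro _ ⟨p, rfl⟩
      show f ((a ≫ (f ⁻¹ᵁ V).ι) p) ∈ B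
      rw [hB]
      refine ⟨?_, ?_⟩
      · rw [Scheme.Hom.comp_apply, Scheme.Opens.ι_apply]
        exact (a p).2
      · rw [hab, Scheme.Hom.comp_apply, Scheme.Opens.ι_apply]
        exact (b p).2
    set d := IsOpenImmersion.lift (f ⁻¹ᵁ B).ι _ hrange with hd
    have hdι : d ≫ (f ⁻¹ᵁ B).ι = a ≫ (f ⁻¹ᵁ V).ι := IsOpenImmersion.lift_fac _ _ _
    have ha : a = d ≫ X.homOfLE hle₁ := by
      rw [← cancel_mono (f ⁻¹ᵁ V).ι, Category.assoc, Scheme.homOfLE_ι, hdι]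
    have hb : b = d ≫ X.homOfLE hle₂ := by
      rw [← cancel_mono (f ⁻¹ᵁ W).ι, Category.assoc, Scheme.homOfLE_ι, hdι, hab]
    rw [ha, hb, Category.assoc, Category.assoc, reassoc_of% hej₁, reassoc_of% hej₂,
      pushout.condition]
  have hg : ∀ x y : Bool, pullback.fst (𝒰.f x) (𝒰.f y) ≫ g x = pullback.snd _ _ ≫ g y := by
    rintro (_ | _) (_ | _)
    · change pullback.fst (f ⁻¹ᵁ W).ι (f ⁻¹ᵁ W).ι ≫ j₂' ≫ pushout.inr u₁ u₂ =
        pullback.snd (f ⁻¹ᵁ W).ι (f ⁻¹ᵁ W).ι ≫ j₂' ≫ pushout.inr u₁ u₂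
      rw [fst_eq_snd_of_mono_eq]
    · change pullback.fst (f ⁻¹ᵁ W).ι (f ⁻¹ᵁ V).ι ≫ j₂' ≫ pushout.inr u₁ u₂ =
        pullback.snd (f ⁻¹ᵁ W).ι (f ⁻¹ᵁ V).ι ≫ j₁' ≫ pushout.inl u₁ u₂
      exact (hcompat _ _ pullback.condition.symm).symm
    · change pullback.fst (f ⁻¹ᵁ V).ι (f ⁻¹ᵁ W).ι ≫ j₁' ≫ pushout.inl u₁ u₂ =
        pullback.snd (f ⁻¹ᵁ V).ι (f ⁻¹ᵁ W).ι ≫ j₂' ≫ pushout.inr u₁ u₂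
      exact hcompat _ _ pullback.condition
    · change pullback.fst (f ⁻¹ᵁ V).ι (f ⁻¹ᵁ V).ι ≫ j₁' ≫ pushout.inl u₁ u₂ =
        pullback.snd (f ⁻¹ᵁ V).ι (f ⁻¹ᵁ V).ι ≫ j₁' ≫ pushout.inl u₁ u₂
      rw [fst_eq_snd_of_mono_eq]
  set j : X ⟶ pushout u₁ u₂ := 𝒰.glueMorphisms g hg with hjdef
  have hjV : (f ⁻¹ᵁ V).ι ≫ j = j₁' ≫ pushout.inl u₁ u₂ := 𝒰.ι_glueMorphisms g hg true
  have hjW : (f ⁻¹ᵁ W).ι ≫ j = j₂' ≫ pushout.inr u₁ u₂ := 𝒰.ι_glueMorphisms g hg false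
  -- `j ≫ ρ = f`
  have hjρ : j ≫ ρ = f := by
    refine Scheme.Cover.hom_ext 𝒰 _ _ ?_
    rintro (_ | _)
    · change (f ⁻¹ᵁ W).ι ≫ j ≫ ρ = (f ⁻¹ᵁ W).ι ≫ f
      rw [reassoc_of% hjW, hrρ, reassoc_of% hj₂'c, hjπ₂]
    · change (f ⁻¹ᵁ V).ι ≫ j ≫ ρ = (f ⁻¹ᵁ V).ι ≫ f
      rw [reassoc_of% hjV, hlρ, reassoc_of% hj₁'c, hjπ₁]
  -- `j` is an open immersion: Zariski-locally over `ρ⁻¹V = Y₁'` and `ρ⁻¹W = Y₂'`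
  have hOV : j ⁻¹ᵁ (ρ ⁻¹ᵁ V) = f ⁻¹ᵁ V := by
    show (j ≫ ρ) ⁻¹ᵁ V = f ⁻¹ᵁ V
    rw [hjρ]
  have hOW : j ⁻¹ᵁ (ρ ⁻¹ᵁ W) = f ⁻¹ᵁ W := by
    show (j ≫ ρ) ⁻¹ᵁ W = f ⁻¹ᵁ W
    rw [hjρ]
  haveI : IsOpenImmersion j := by
    apply IsZariskiLocalAtTarget.of_iSup_eq_top (P := @IsOpenImmersion)
      (fun b : Bool => cond b (ρ ⁻¹ᵁ V) (ρ ⁻¹ᵁ W))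
      (by
        rw [iSup_bool_eq]
        show ρ ⁻¹ᵁ (V ⊔ W) = ⊤
        rw [hVW]
        rfl)
    rintro (_ | _)
    · change IsOpenImmersion (j ∣_ (ρ ⁻¹ᵁ W))
      have h1 : (j ⁻¹ᵁ (ρ ⁻¹ᵁ W)).ι ≫ j = (X.isoOfEq hOW).hom ≫ j₂' ≫ pushout.inr u₁ u₂ := by
        rw [← hjW, Scheme.isoOfEq_hom_ι_assoc]
      haveI : IsOpenImmersion ((j ∣_ (ρ ⁻¹ᵁ W)) ≫ (ρ ⁻¹ᵁ W).ι) := by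
        rw [morphismRestrict_ι, h1]
        infer_instance
      exact IsOpenImmersion.of_comp _ (ρ ⁻¹ᵁ W).ι
    · change IsOpenImmersion (j ∣_ (ρ ⁻¹ᵁ V))
      have h1 : (j ⁻¹ᵁ (ρ ⁻¹ᵁ V)).ι ≫ j = (X.isoOfEq hOV).hom ≫ j₁' ≫ pushout.inl u₁ u₂ := by
        rw [← hjV, Scheme.isoOfEq_hom_ι_assoc]
      haveI : IsOpenImmersion ((j ∣_ (ρ ⁻¹ᵁ V)) ≫ (ρ ⁻¹ᵁ V).ι) := by
        rw [morphismRestrict_ι, h1]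
        infer_instance
      exact IsOpenImmersion.of_comp _ (ρ ⁻¹ᵁ V).ι
  exact ⟨pushout u₁ u₂, j, ρ, inferInstance, inferInstance, hjρ⟩

/-! ## From affine bases to quasi-compact quasi-separated bases -/

/-- **Compactifiability over a quasi-compact quasi-separated base follows from compactifiability
over its affine opens** (induction over a finite affine open cover, gluing one affine open at a
time by `exists_compactification_of_iSup_eq_top₂`). Conditional on `Stacks081R`.
[cite: Conrad2007, Remark 2.12 and §4; StacksProject, Tag 0F41] -/
theorem exists_compactification_of_forall_affineOpens (h081R : Stacks081R.{u}) {X S : Scheme.{u}}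
    [CompactSpace S] [QuasiSeparatedSpace S] (f : X ⟶ S) [QuasiCompact f]
    (h : ∀ U : S.affineOpens, ∃ (Y : Scheme.{u}) (j : ↑(f ⁻¹ᵁ (U : S.Opens)) ⟶ Y)
      (q : Y ⟶ (U : S.Opens)), IsOpenImmersion j ∧ IsProper q ∧ j ≫ q = f ∣_ (U : S.Opens)) :
    ∃ (Y : Scheme.{u}) (j : X ⟶ Y) (q : Y ⟶ S), IsOpenImmersion j ∧ IsProper q ∧ j ≫ q = f := by
  classical
  obtain ⟨t, ht⟩ := exists_finset_affineOpens_iSup_eq_top S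
  -- induction over the finite affine cover: compactifications of `f` over `⋃_{U ∈ t'} U`
  have key : ∀ t' : Finset S.affineOpens,
      IsCompact (((⨆ U ∈ t', (U : S.Opens) : S.Opens)) : Set S) ∧
      ∃ (Y : Scheme.{u}) (j : ↑(f ⁻¹ᵁ (⨆ U ∈ t', (U : S.Opens))) ⟶ Y)
        (q : Y ⟶ ↑(⨆ U ∈ t', (U : S.Opens))),
        IsOpenImmersion j ∧ IsProper q ∧ j ≫ q = f ∣_ (⨆ U ∈ t', (U : S.Opens)) := by
    intro t'
    induction t' using Finset.induction_on with
    | empty =>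
      have h0 : (⨆ U ∈ (∅ : Finset S.affineOpens), (U : S.Opens)) = ⊥ := by simp
      haveI : IsEmpty ↑(f ⁻¹ᵁ (⨆ U ∈ (∅ : Finset S.affineOpens), (U : S.Opens))) :=
        ⟨fun x => by
          obtain ⟨y, hy⟩ := x
          have hy' : f y ∈ ((⨆ U ∈ (∅ : Finset S.affineOpens), (U : S.Opens)) : S.Opens) := hy
          have hbot : f y ∈ (⊥ : S.Opens) := h0 ▸ hy'
          exact hbot⟩
      refine ⟨by rw [h0]; exact isCompact_empty, _, 𝟙 _, f ∣_ _, inferInstance, inferInstance,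
        Category.id_comp _⟩
    | insert A t' hA ih =>
      obtain ⟨hOc, hO⟩ := ih
      -- the new open `O' = A ∪ O`
      have hO' : (⨆ U ∈ insert A t', (U : S.Opens)) = (A : S.Opens) ⊔ ⨆ U ∈ t', (U : S.Opens) :=
        Finset.iSup_insert A t' _
      set O : S.Opens := ⨆ U ∈ t', (U : S.Opens) with hOdef
      set O' : S.Opens := ⨆ U ∈ insert A t', (U : S.Opens) with hO'def
      have hO'c : IsCompact (O' : Set S) := by
        rw [hO', Opens.coe_sup]
        exact A.2.isCompact.union hOc
      refine ⟨hO'c, ?_⟩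
      haveI : CompactSpace O' := isCompact_iff_compactSpace.mp hO'c
      haveI : QuasiSeparatedSpace O' :=
        QuasiSeparatedSpace.of_isOpenEmbedding O'.ι.isOpenEmbedding
      have hAO' : (A : S.Opens) ≤ O' := hO' ▸ le_sup_left
      have hOO' : O ≤ O' := hO' ▸ le_sup_right
      -- glue over `O' = O'↓O ∪ O'↓A`
      have hcov : (O'.ι ⁻¹ᵁ O) ⊔ (O'.ι ⁻¹ᵁ (A : S.Opens)) = ⊤ := by
        apply Opens.ext
        rw [Opens.coe_sup, Opens.coe_top, Set.eq_univ_iff_forall]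
        intro x
        have hx : x.1 ∈ ((A : S.Opens) ⊔ O : S.Opens) := hO' ▸ x.2
        rcases hx with hx | hx
        · exact Or.inr hx
        · exact Or.inl hx
      have hglue := exists_compactification_of_iSup_eq_top₂ h081R (f ∣_ O') (O'.ι ⁻¹ᵁ O)
        (O'.ι ⁻¹ᵁ (A : S.Opens)) (O'.ι.isCompact_preimage hOc)
        (O'.ι.isCompact_preimage A.2.isCompact) hcov
      -- identify `(f|_{O'})|_{O'↓U}` with `f|_U` for `U = O, A`
      have htrans : ∀ (U : S.Opens) (hU : U ≤ O'),
          (∃ (Y : Scheme.{u}) (j : ↑(f ⁻¹ᵁ U) ⟶ Y) (q : Y ⟶ U),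
            IsOpenImmersion j ∧ IsProper q ∧ j ≫ q = f ∣_ U) →
          ∃ (Y : Scheme.{u}) (j : ↑((f ∣_ O') ⁻¹ᵁ (O'.ι ⁻¹ᵁ U)) ⟶ Y) (q : Y ⟶ ↑(O'.ι ⁻¹ᵁ U)),
            IsOpenImmersion j ∧ IsProper q ∧ j ≫ q = (f ∣_ O') ∣_ (O'.ι ⁻¹ᵁ U) := by
        intro U hU hU'
        have hUU' : O'.ι ''ᵁ (O'.ι ⁻¹ᵁ U) = U := by
          rw [Scheme.Hom.image_preimage_eq_opensRange_inf, Scheme.Opens.opensRange_ι,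
            inf_eq_right]
          exact hU
        exact exists_compactification_of_arrow_iso
          (morphismRestrictRestrict f O' (O'.ι ⁻¹ᵁ U) ≪≫ morphismRestrictEq f hUU').symm hU'
      obtain ⟨Y, j, q, hj, hq, hjq⟩ := hglue (htrans O hOO' hO) (htrans A hAO' (h A))
      exact ⟨Y, j, q, hj, hq, hjq⟩
  -- the whole of `S`
  obtain ⟨-, Y, j, q, hj, hq, hjq⟩ := key t
  have htop : (⨆ U ∈ t, (U : S.Opens)) = ⊤ := top_le_iff.mp ht
  haveI := hj
  haveI := hq
  have hXtop : f ⁻¹ᵁ (⨆ U ∈ t, (U : S.Opens)) = ⊤ := by rw [htop]; rfl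
  haveI : IsProper ((S.isoOfEq htop).hom ≫ S.topIso.hom) := MorphismProperty.of_isIso @IsProper _
  refine ⟨Y, (X.topIso.inv ≫ (X.isoOfEq hXtop).inv) ≫ j, q ≫ (S.isoOfEq htop).hom ≫ S.topIso.hom,
    inferInstance, inferInstance, ?_⟩
  rw [Scheme.topIso_hom, Category.assoc, Category.assoc, reassoc_of% hjq, Scheme.isoOfEq_hom_ι,
    morphismRestrict_ι, Scheme.isoOfEq_inv_ι_assoc, ← Scheme.topIso_hom, Iso.inv_hom_id_assoc]

/-! ## Nagata's theorem from Raynaud–Gruson flattening and the two-piece lemma -/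

/-- `exists_compactification_affineBase_of_twoPiece` with the two-piece hypothesis (Stacks
0F40) only required over AFFINE bases (which is all its proof uses: the Noetherian model lives
over `Spec A₀`): over an affine base `Spec B`, every separated morphism of finite type is
compactifiable, granted (a) compactifiability of affine schemes of finite type (all bases) and
(b) Stacks 0F40 for Noetherian total spaces over affine bases. Proof verbatim as there
(Stacks 09ZP Noetherian model, the Noetherian case, base change, immersion).
[cite: StacksProject, Tag 0F41 (proof, reduction to the Noetherian case)] -/
theorem exists_compactification_affineBase_of_twoPiece'
    (hAff : ∀ ⦃S U : Scheme.{u}⦄ [IsAffine U] (g : U ⟶ S) [LocallyOfFiniteType g] [QuasiCompact g],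
      ∃ (Uc : Scheme.{u}) (j : U ⟶ Uc) (h : Uc ⟶ S), IsOpenImmersion j ∧ IsProper h ∧ j ≫ h = g)
    (h0F40 : ∀ ⦃S X : Scheme.{u}⦄ [IsAffine S] [IsNoetherian X] (f : X ⟶ S) [IsSeparated f]
      [LocallyOfFiniteType f] (W W₁ W₂ : X.Opens), W₁ ⊔ W₂ = W →
      Dense (W.ι ⁻¹' ((W₁ ⊓ W₂ : X.Opens) : Set X)) →
      (∃ (Wc : Scheme.{u}) (j : ↑W₁ ⟶ Wc) (h : Wc ⟶ S),
        IsOpenImmersion j ∧ IsProper h ∧ j ≫ h = W₁.ι ≫ f) →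
      (∃ (Wc : Scheme.{u}) (j : ↑W₂ ⟶ Wc) (h : Wc ⟶ S),
        IsOpenImmersion j ∧ IsProper h ∧ j ≫ h = W₂.ι ≫ f) →
      ∃ (Wc : Scheme.{u}) (j : ↑W ⟶ Wc) (h : Wc ⟶ S),
        IsOpenImmersion j ∧ IsProper h ∧ j ≫ h = W.ι ≫ f)
    {B : Type u} [CommRing B] {Y : Scheme.{u}} (g : Y ⟶ Spec (.of B)) [IsSeparated g]
    [LocallyOfFiniteType g] [QuasiCompact g] :
    ∃ (Yc : Scheme.{u}) (j : Y ⟶ Yc) (h : Yc ⟶ Spec (.of B)),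
      IsOpenImmersion j ∧ IsProper h ∧ j ≫ h = g := by
  obtain ⟨A₀, _, φ, Y₀, p, j, hA₀, -, -, hp₁, hp₂, hp₃, hj, hjg⟩ :=
    Literature.AlgebraicGeometry.Limits.exists_finiteTypeModel g
  haveI := hp₁
  haveI := hp₂
  haveI := hp₃
  haveI := hj
  -- `Y₀` is Noetherian: of finite type over the Noetherian `Spec A₀`
  haveI : IsNoetherianRing (CommRingCat.of A₀) := hA₀
  haveI : IsLocallyNoetherian Y₀ := LocallyOfFiniteType.isLocallyNoetherian p
  haveI : CompactSpace Y₀ := QuasiCompact.compactSpace_of_compactSpace p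
  haveI : IsNoetherian Y₀ := { }
  -- compactify `Y₀ → Spec A₀`
  obtain hY₀ := exists_compactification_of_isNoetherian_of_twoPiece p
    (fun U hU => by haveI : IsAffine U := hU; exact hAff (U.ι ≫ p)) (h0F40 p)
  -- base change to `Spec B`, then the closed immersion `Y ↪ Y₀ ×_{A₀} Spec B`
  obtain ⟨Zc, j', h', hj', hh', hfac⟩ :=
    exists_compactification_pullback_snd p (Spec.map (CommRingCat.ofHom φ)) hY₀
  haveI := hj'
  haveI := hh'
  haveI : QuasiCompact (j' ≫ h') := hfac ▸ inferInstance
  haveI : QuasiCompact j' := .of_comp j' h'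
  obtain ⟨Yc, k, h, hk, hh, hkh⟩ := exists_compactification_of_immersion (j ≫ j') h'
  exact ⟨Yc, k, h, hk, hh, by rw [hkh, Category.assoc, hfac, hjg]⟩

/-- **Nagata's compactification theorem (`NagataCompactification`, Conrad 2007 Thm. 4.1 /
Stacks 0F41) from Raynaud–Gruson flattening (`Stacks081R`) and the two-piece lemma (Stacks
0F40, hypothesis `h0F40`: for Noetherian total spaces over AFFINE bases only, in the form of
`exists_compactification_affineBase_of_twoPiece'`).**
Over the affine opens `U` of `S`, `f|_U` is compactifiable by the Noetherian case
(`exists_compactification_affineBase_of_twoPiece`: Noetherian approximation over an affine base,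
the induction of Tag 0F41 over a dense affine cover, `𝐏ⁿ` for the affine pieces); these glue by
`exists_compactification_of_forall_affineOpens`. [cite: Conrad2007, Thm. 4.1; StacksProject, Tag 0F41] -/
theorem nagataCompactification_of_stacks081R_of_twoPiece (h081R : Stacks081R.{u})
    (h0F40 : ∀ ⦃S X : Scheme.{u}⦄ [IsAffine S] [IsNoetherian X] (f : X ⟶ S) [IsSeparated f]
      [LocallyOfFiniteType f] (W W₁ W₂ : X.Opens), W₁ ⊔ W₂ = W →
      Dense (W.ι ⁻¹' ((W₁ ⊓ W₂ : X.Opens) : Set X)) →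
      (∃ (Wc : Scheme.{u}) (j : ↑W₁ ⟶ Wc) (h : Wc ⟶ S),
        IsOpenImmersion j ∧ IsProper h ∧ j ≫ h = W₁.ι ≫ f) →
      (∃ (Wc : Scheme.{u}) (j : ↑W₂ ⟶ Wc) (h : Wc ⟶ S),
        IsOpenImmersion j ∧ IsProper h ∧ j ≫ h = W₂.ι ≫ f) →
      ∃ (Wc : Scheme.{u}) (j : ↑W ⟶ Wc) (h : Wc ⟶ S),
        IsOpenImmersion j ∧ IsProper h ∧ j ≫ h = W.ι ≫ f) :
    NagataCompactification.{u} := by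
  intro X S f _ _ _ _ _
  refine exists_compactification_of_forall_affineOpens h081R f fun U => ?_
  haveI : IsAffine (U : S.Opens) := U.2
  -- over the affine `U ≅ Spec Γ(U)`
  obtain ⟨Y, j, q, hj, hq, hjq⟩ := exists_compactification_affineBase_of_twoPiece'
    (fun S U _ g _ _ => exists_compactification_of_isAffine g) h0F40
    ((f ∣_ (U : S.Opens)) ≫ (Scheme.isoSpec (U : S.Opens)).hom)
  haveI := hq
  exact ⟨Y, j, q ≫ (Scheme.isoSpec (U : S.Opens)).inv, hj, inferInstance, by
    rw [reassoc_of% hjq, Iso.hom_inv_id, Category.comp_id]⟩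

end Literature.AlgebraicGeometry.Morphisms

end
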